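import Literature.Probability.Percolation.ZdFourArmSeparated
import HarnessLib

/-!
# The four-arm event of bond percolation on `ℤ²` fenced and landed on the OUTER square only

Topic `Literature/Probability/Percolation`; critical bond percolation on `ℤ²`. DEFINITIONS and their
structural lemmas (no named fact).

The intermediate event of Kesten's arm-separation scheme (H. Kesten, CMP 109 (1987), §2, Lemmas 4
and 5; P. Nolin, EJP 13 (2008), §4.4 [arXiv 0711.4948, pp. 12–13]: "1. External extremities … 2.
Internal extremities"): after the external half of the scheme the four alternating arms of
`A₄(n, N)` are fenced and landed on the fixed zones of the OUTER square `∂B(N)` — exactly as in the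
well-separated event `zdFourArmSep n N` (`ZdFourArmSeparated.lean`) — while their INNER extremities
are still free on `∂B(n)`; the internal half (run second, inwards) then turns this event into
`zdFourArmSep`. This file defines that event, `zdFourArmOutLanded n N` (the `OutLanded n N` of the
blueprint in `ZdFourArmSeparationStep.lean`), and proves what the inward multi-scale summation
(`le_mul_of_separationScheme_upto` through `real_le_add_mul_of_surgery`) needs of it:

* `ZdOutOpenArmR/L`, `ZdOutDualArmT/B` — one outer-fenced open arm to the right / left side (body an
  open walk of `A_{n,N}` from ANY site of the sphere `‖x‖_∞ = n` to the outer landing zone, outer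
  fence as in `ZdSepOpenArmR/L`), one outer-fenced closed dual arm to the top / bottom side (body a
  walk of faces from ANY face inside `B(n)` to the face row `N` / `-N-1`, crossing closed edges with
  both endpoints in `A_{n,N}`, outer fence as in `ZdSepDualArmT/B`);
* `zdFourArmOutLanded n N` — the event (increasing part `∩` decreasing part), `isUpperSet_…`,
  `isLowerSet_…`;
* `zdFourArmSep_subset_zdFourArmOutLanded` — forgetting the inner fences;
* `zdFourArmOutLanded_mono_left` — **raising the inner radius** `n ≤ n' ≤ N`:
  `zdFourArmOutLanded n N ⊆ zdFourArmOutLanded n' N` (cut each body at its last visit inside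
  `B(n'-1)`; the side condition `E ⊆ E'` of `real_le_add_mul_of_surgery` read inwards);
* `determinedBy_zdFourArmOutLanded` — for `2n ≤ N` the event is determined by the pairs of the
  annulus `B(N + N/8 + 1) ∖ B(n-1)` (hence independent of any event read inside `B(n-1)`,
  `disjoint_annulusPairs_of_exists_mem_box`), and `measurableSet_zdFourArmOutLanded`.

## References

* H. Kesten, *Scaling relations for 2D-percolation*, Comm. Math. Phys. 109 (1987), §2, Lemmas 4–5
  [KestenScalingCMP1987].
* P. Nolin, *Near-critical percolation in two dimensions*, EJP 13 (2008), §4.2 Def. 7–9, §4.4 proof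
  of Thm. 11 [arXiv 0711.4948: Def. 6–8, Thm. 10, pp. 12–13] [Nolin2008].
* H. Duminil-Copin, I. Manolescu, V. Tassion, PTRF 181 (2021), §6.2 Def. 6.1 (well-separated arms)
  [DuminilCopinManolescuTassion2021].

Tree: `ZdSepOpenArmR/L`, `ZdSepDualArmT/B`, `zdFourArmSep` (`ZdFiveArmSeparated.lean`,
`ZdFourArmSeparated.lean`); `exists_prefix_exit` (`FourArmGarbanTwoArms.lean`); `sepEdge`,
`stepKind_of_adj` (`PlanarDuality.lean`); `DeterminedBy` (`PercolationEvents.lean`).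
-/

noncomputable section

open MeasureTheory Set SimpleGraph

namespace Literature.Probability.Percolation

open LatticeModels

/-! ### The four outer-fenced arms -/

/-- **An outer-fenced open arm to the right side with free inner end**: an open walk `W` of
`A_{n,N}` from a site `x` of the sphere `‖x‖_∞ = n` to `z = (N, z₁)`, `lo' ≤ z₁ ≤ hi'`, with the
outer fence of `ZdSepOpenArmR` (an open bottom-to-top crossing `V` of
`[N+1, N+N/8] × [z₁ ± N/64]` and an open walk `P` from `z` to `V` inside `{‖· - z‖_∞ < N/8}`).
[cite: Nolin2008, §4.2 (arXiv 0711.4948 Def. 6–8: well-separated on the external boundary only, the events Ã^{·/η'})] -/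
structure ZdOutOpenArmR (ω : BondConfig (Site 2)) (n N : ℕ) (lo' hi' : ℤ) where
  /-- inner endpoint (anywhere on the sphere `‖·‖_∞ = n`) -/
  x : Site 2
  /-- outer endpoint -/
  z : Site 2
  /-- the body -/
  W : (zdGraph 2).Walk x z
  hx : x ∈ siteSphere n
  hz : z 0 = N ∧ lo' ≤ z 1 ∧ z 1 ≤ hi'
  hW : ∀ v ∈ W.support, v ∈ sqAnnulus n N
  hWo : ∀ e ∈ W.edges, e ∈ ω
  /-- bottom end of the outer fence crossing -/
  a : Site 2
  /-- top end of the outer fence crossing -/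
  b : Site 2
  /-- attaching vertex on the outer fence crossing -/
  u : Site 2
  /-- the outer fence crossing -/
  V : (zdGraph 2).Walk a b
  /-- the outer attaching walk -/
  P : (zdGraph 2).Walk z u
  hab : a 1 = z 1 - (N / 64 : ℕ) ∧ b 1 = z 1 + (N / 64 : ℕ)
  hV : ∀ v ∈ V.support, (N : ℤ) + 1 ≤ v 0 ∧ v 0 ≤ N + (N / 8 : ℕ) ∧ |v 1 - z 1| ≤ (N / 64 : ℕ)
  hVo : ∀ e ∈ V.edges, e ∈ ω
  hu : u ∈ V.support
  hP : ∀ v ∈ P.support, |v 0 - z 0| + 1 ≤ (N / 8 : ℕ) ∧ |v 1 - z 1| + 1 ≤ (N / 8 : ℕ)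
  hPo : ∀ e ∈ P.edges, e ∈ ω

/-- **An outer-fenced open arm to the left side with free inner end** (mirror image of
`ZdOutOpenArmR`). [cite: Nolin2008, §4.2 (arXiv 0711.4948 Def. 6–8)] -/
structure ZdOutOpenArmL (ω : BondConfig (Site 2)) (n N : ℕ) (lo' hi' : ℤ) where
  /-- inner endpoint (anywhere on the sphere `‖·‖_∞ = n`) -/
  x : Site 2
  /-- outer endpoint -/
  z : Site 2
  /-- the body -/
  W : (zdGraph 2).Walk x z
  hx : x ∈ siteSphere n
  hz : z 0 = -(N : ℤ) ∧ lo' ≤ z 1 ∧ z 1 ≤ hi'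
  hW : ∀ v ∈ W.support, v ∈ sqAnnulus n N
  hWo : ∀ e ∈ W.edges, e ∈ ω
  /-- bottom end of the outer fence crossing -/
  a : Site 2
  /-- top end of the outer fence crossing -/
  b : Site 2
  /-- attaching vertex on the outer fence crossing -/
  u : Site 2
  /-- the outer fence crossing -/
  V : (zdGraph 2).Walk a b
  /-- the outer attaching walk -/
  P : (zdGraph 2).Walk z u
  hab : a 1 = z 1 - (N / 64 : ℕ) ∧ b 1 = z 1 + (N / 64 : ℕ)
  hV : ∀ v ∈ V.support, -((N : ℤ) + (N / 8 : ℕ)) ≤ v 0 ∧ v 0 + 1 ≤ -(N : ℤ) ∧ |v 1 - z 1| ≤ (N / 64 : ℕ)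
  hVo : ∀ e ∈ V.edges, e ∈ ω
  hu : u ∈ V.support
  hP : ∀ v ∈ P.support, |v 0 - z 0| + 1 ≤ (N / 8 : ℕ) ∧ |v 1 - z 1| + 1 ≤ (N / 8 : ℕ)
  hPo : ∀ e ∈ P.edges, e ∈ ω

/-- **An outer-fenced closed dual arm to the top side with free inner end**: a walk of faces `Q`
from a face `f` lying inside `B(n)` (all four corners in `B(n)`) to the face `g = (g₀, N)` just
outside the outer top side, `lo' ≤ g₀ ≤ hi'`, each step crossing a CLOSED edge with both endpoints
in `A_{n,N}`, with the outer fence of `ZdSepDualArmT`. [cite: Nolin2008, §4.2 (arXiv 0711.4948 Def. 6–8, free spaces for the dual colour, external boundary only)] -/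
structure ZdOutDualArmT (ω : BondConfig (Site 2)) (n N : ℕ) (lo' hi' : ℤ) where
  /-- start face (inside `B(n)`) -/
  f : Site 2
  /-- end face (outside) -/
  g : Site 2
  /-- the body -/
  Q : (zdGraph 2).Walk f g
  hf : -(n : ℤ) ≤ f 0 ∧ f 0 + 1 ≤ n ∧ -(n : ℤ) ≤ f 1 ∧ f 1 + 1 ≤ n
  hg : g 1 = N ∧ lo' ≤ g 0 ∧ g 0 ≤ hi'
  hQc : ∀ d ∈ Q.darts, sepEdge d.fst d.snd ∉ ω
  hQa : ∀ d ∈ Q.darts, ∀ v ∈ sepEdge d.fst d.snd, v ∈ sqAnnulus n N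
  /-- left end of the outer fence crossing -/
  a : Site 2
  /-- right end of the outer fence crossing -/
  b : Site 2
  /-- attaching face on the outer fence crossing -/
  u : Site 2
  /-- the outer fence crossing -/
  C : (zdGraph 2).Walk a b
  /-- the outer attaching walk -/
  P : (zdGraph 2).Walk g u
  hab : a 0 = g 0 - (N / 64 : ℕ) ∧ b 0 = g 0 + (N / 64 : ℕ)
  hC : ∀ w ∈ C.support, |w 0 - g 0| ≤ (N / 64 : ℕ) ∧ (N : ℤ) + 1 ≤ w 1 ∧ w 1 ≤ N + (N / 8 : ℕ)
  hCc : ∀ d ∈ C.darts, sepEdge d.fst d.snd ∉ ω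
  hu : u ∈ C.support
  hP : ∀ w ∈ P.support, |w 0 - g 0| + 1 ≤ (N / 8 : ℕ) ∧ |w 1 - g 1| + 1 ≤ (N / 8 : ℕ)
  hPc : ∀ d ∈ P.darts, sepEdge d.fst d.snd ∉ ω

/-- **An outer-fenced closed dual arm to the bottom side with free inner end** (mirror image of
`ZdOutDualArmT`: end face `g = (g₀, -N-1)`, fence in the face rows `-N-1-N/8 … -N-2`). [cite: Nolin2008, §4.2 (arXiv 0711.4948 Def. 6–8)] -/
structure ZdOutDualArmB (ω : BondConfig (Site 2)) (n N : ℕ) (lo' hi' : ℤ) where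
  /-- start face (inside `B(n)`) -/
  f : Site 2
  /-- end face (outside) -/
  g : Site 2
  /-- the body -/
  Q : (zdGraph 2).Walk f g
  hf : -(n : ℤ) ≤ f 0 ∧ f 0 + 1 ≤ n ∧ -(n : ℤ) ≤ f 1 ∧ f 1 + 1 ≤ n
  hg : g 1 + 1 = -(N : ℤ) ∧ lo' ≤ g 0 ∧ g 0 ≤ hi'
  hQc : ∀ d ∈ Q.darts, sepEdge d.fst d.snd ∉ ω
  hQa : ∀ d ∈ Q.darts, ∀ v ∈ sepEdge d.fst d.snd, v ∈ sqAnnulus n N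
  /-- left end of the outer fence crossing -/
  a : Site 2
  /-- right end of the outer fence crossing -/
  b : Site 2
  /-- attaching face on the outer fence crossing -/
  u : Site 2
  /-- the outer fence crossing -/
  C : (zdGraph 2).Walk a b
  /-- the outer attaching walk -/
  P : (zdGraph 2).Walk g u
  hab : a 0 = g 0 - (N / 64 : ℕ) ∧ b 0 = g 0 + (N / 64 : ℕ)
  hC : ∀ w ∈ C.support, |w 0 - g 0| ≤ (N / 64 : ℕ) ∧ -((N : ℤ) + 1 + (N / 8 : ℕ)) ≤ w 1 ∧ w 1 + 2 ≤ -(N : ℤ)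
  hCc : ∀ d ∈ C.darts, sepEdge d.fst d.snd ∉ ω
  hu : u ∈ C.support
  hP : ∀ w ∈ P.support, |w 0 - g 0| + 1 ≤ (N / 8 : ℕ) ∧ |w 1 - g 1| + 1 ≤ (N / 8 : ℕ)
  hPc : ∀ d ∈ P.darts, sepEdge d.fst d.snd ∉ ω

/-! ### The events -/

/-- The outer-fenced right arm event (outer landing heights `[0, N/64]`). [cite: Nolin2008, §4.2 (arXiv 0711.4948 Def. 8, the events Ā^{·/I'})] -/
def zdOutOpenArmR (n N : ℕ) : Set (BondConfig (Site 2)) :=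
  {ω | Nonempty (ZdOutOpenArmR ω n N 0 (N / 64 : ℕ))}

/-- The outer-fenced left arm event. [cite: Nolin2008, §4.2 (arXiv 0711.4948 Def. 8)] -/
def zdOutOpenArmL (n N : ℕ) : Set (BondConfig (Site 2)) :=
  {ω | Nonempty (ZdOutOpenArmL ω n N 0 (N / 64 : ℕ))}

/-- The outer-fenced top dual arm event. [cite: Nolin2008, §4.2 (arXiv 0711.4948 Def. 8)] -/
def zdOutDualArmT (n N : ℕ) : Set (BondConfig (Site 2)) :=
  {ω | Nonempty (ZdOutDualArmT ω n N 0 (N / 64 : ℕ))}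

/-- The outer-fenced bottom dual arm event. [cite: Nolin2008, §4.2 (arXiv 0711.4948 Def. 8)] -/
def zdOutDualArmB (n N : ℕ) : Set (BondConfig (Site 2)) :=
  {ω | Nonempty (ZdOutDualArmB ω n N 0 (N / 64 : ℕ))}

/-- **The four-arm event fenced and landed on the outer square only** (`OutLanded n N` of the
blueprint of `ZdFourArmSeparationStep.lean`; Nolin's `Ã̃^{·/η',I'}_{4,BWBW}(n,N)`, `η' = 1/64`):
outer-fenced open arms to the right and left sides and outer-fenced closed dual arms to the top
and bottom sides, inner extremities free — an increasing event meet a decreasing one.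
[cite: Nolin2008, §4.4, proof of Thm. 11, "1. External extremities" (arXiv 0711.4948: Thm. 10, p. 12)] [cite: KestenScalingCMP1987, §2 Lemma 4] -/
def zdFourArmOutLanded (n N : ℕ) : Set (BondConfig (Site 2)) :=
  (zdOutOpenArmR n N ∩ zdOutOpenArmL n N) ∩ (zdOutDualArmT n N ∩ zdOutDualArmB n N)

/-- Unfolding. [folklore] -/
theorem zdFourArmOutLanded_eq (n N : ℕ) :
    zdFourArmOutLanded n N =
      (zdOutOpenArmR n N ∩ zdOutOpenArmL n N) ∩ (zdOutDualArmT n N ∩ zdOutDualArmB n N) := rfl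

/-! ### Monotonicity in the configuration -/

section Mono

variable {ω ω' : BondConfig (Site 2)} {n N : ℕ} {lo' hi' : ℤ}

/-- An outer-fenced right arm of `ω` is one of every larger configuration. [folklore] -/
def ZdOutOpenArmR.mono (A : ZdOutOpenArmR ω n N lo' hi') (h : ω ⊆ ω') : ZdOutOpenArmR ω' n N lo' hi' where
  x := A.x
  z := A.z
  W := A.W
  hx := A.hx
  hz := A.hz
  hW := A.hW
  hWo e he := h (A.hWo e he)
  a := A.a
  b := A.b
  u := A.u
  V := A.V
  P := A.P
  hab := A.hab
  hV := A.hV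
  hVo e he := h (A.hVo e he)
  hu := A.hu
  hP := A.hP
  hPo e he := h (A.hPo e he)

/-- An outer-fenced left arm of `ω` is one of every larger configuration. [folklore] -/
def ZdOutOpenArmL.mono (A : ZdOutOpenArmL ω n N lo' hi') (h : ω ⊆ ω') : ZdOutOpenArmL ω' n N lo' hi' where
  x := A.x
  z := A.z
  W := A.W
  hx := A.hx
  hz := A.hz
  hW := A.hW
  hWo e he := h (A.hWo e he)
  a := A.a
  b := A.b
  u := A.u
  V := A.V
  P := A.P
  hab := A.hab
  hV := A.hV
  hVo e he := h (A.hVo e he)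
  hu := A.hu
  hP := A.hP
  hPo e he := h (A.hPo e he)

/-- An outer-fenced top dual arm of `ω` is one of every smaller configuration. [folklore] -/
def ZdOutDualArmT.anti (D : ZdOutDualArmT ω n N lo' hi') (h : ω' ⊆ ω) : ZdOutDualArmT ω' n N lo' hi' where
  f := D.f
  g := D.g
  Q := D.Q
  hf := D.hf
  hg := D.hg
  hQc d hd hmem := D.hQc d hd (h hmem)
  hQa := D.hQa
  a := D.a
  b := D.b
  u := D.u
  C := D.C
  P := D.P
  hab := D.hab
  hC := D.hC
  hCc d hd hmem := D.hCc d hd (h hmem)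
  hu := D.hu
  hP := D.hP
  hPc d hd hmem := D.hPc d hd (h hmem)

/-- An outer-fenced bottom dual arm of `ω` is one of every smaller configuration. [folklore] -/
def ZdOutDualArmB.anti (D : ZdOutDualArmB ω n N lo' hi') (h : ω' ⊆ ω) : ZdOutDualArmB ω' n N lo' hi' where
  f := D.f
  g := D.g
  Q := D.Q
  hf := D.hf
  hg := D.hg
  hQc d hd hmem := D.hQc d hd (h hmem)
  hQa := D.hQa
  a := D.a
  b := D.b
  u := D.u
  C := D.C
  P := D.P
  hab := D.hab
  hC := D.hC
  hCc d hd hmem := D.hCc d hd (h hmem)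
  hu := D.hu
  hP := D.hP
  hPc d hd hmem := D.hPc d hd (h hmem)

/-- The open part is increasing. [folklore] -/
theorem isUpperSet_zdOutOpenArmR_inter_zdOutOpenArmL (n N : ℕ) :
    IsUpperSet (zdOutOpenArmR n N ∩ zdOutOpenArmL n N) := by
  rintro ω ω' hle ⟨⟨A⟩, ⟨B⟩⟩
  exact ⟨⟨A.mono hle⟩, ⟨B.mono hle⟩⟩

/-- The dual part is decreasing. [folklore] -/
theorem isLowerSet_zdOutDualArmT_inter_zdOutDualArmB (n N : ℕ) :
    IsLowerSet (zdOutDualArmT n N ∩ zdOutDualArmB n N) := by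
  rintro ω ω' hle ⟨⟨T⟩, ⟨D⟩⟩
  exact ⟨⟨T.anti hle⟩, ⟨D.anti hle⟩⟩

end Mono

/-! ### Forgetting the inner fences: `zdFourArmSep ⊆ zdFourArmOutLanded` -/

section Forget

variable {ω : BondConfig (Site 2)} {n N : ℕ} {lo hi lo' hi' : ℤ}

/-- A fenced right arm is an outer-fenced right arm (`1 ≤ n`, `|lo|, |hi| ≤ n`). [folklore] -/
def ZdSepOpenArmR.toOut (A : ZdSepOpenArmR ω n N lo hi lo' hi') (hn : 1 ≤ n) (hlo : -(n : ℤ) ≤ lo)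
    (hhi : hi ≤ n) : ZdOutOpenArmR ω n N lo' hi' where
  x := A.x
  z := A.z
  W := A.W
  hx := by
    have hx := A.hx
    exact mem_siteSphere_of_apply_zero hn (Or.inl hx.1) (abs_le.2 ⟨by omega, by omega⟩)
  hz := A.hz
  hW := A.hW
  hWo := A.hWo
  a := A.a
  b := A.b
  u := A.u
  V := A.V
  P := A.P
  hab := A.hab
  hV := A.hV
  hVo := A.hVo
  hu := A.hu
  hP := A.hP
  hPo := A.hPo

/-- A fenced left arm is an outer-fenced left arm. [folklore] -/
def ZdSepOpenArmL.toOut (A : ZdSepOpenArmL ω n N lo hi lo' hi') (hn : 1 ≤ n) (hlo : -(n : ℤ) ≤ lo)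
    (hhi : hi ≤ n) : ZdOutOpenArmL ω n N lo' hi' where
  x := A.x
  z := A.z
  W := A.W
  hx := by
    have hx := A.hx
    exact mem_siteSphere_of_apply_zero hn (Or.inr hx.1) (abs_le.2 ⟨by omega, by omega⟩)
  hz := A.hz
  hW := A.hW
  hWo := A.hWo
  a := A.a
  b := A.b
  u := A.u
  V := A.V
  P := A.P
  hab := A.hab
  hV := A.hV
  hVo := A.hVo
  hu := A.hu
  hP := A.hP
  hPo := A.hPo

/-- A fenced top dual arm is an outer-fenced top dual arm (`1 ≤ n`, `-n ≤ lo`, `hi + 1 ≤ n`). [folklore] -/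
def ZdSepDualArmT.toOut (D : ZdSepDualArmT ω n N lo hi lo' hi') (hn : 1 ≤ n) (hlo : -(n : ℤ) ≤ lo)
    (hhi : hi + 1 ≤ n) : ZdOutDualArmT ω n N lo' hi' where
  f := D.f
  g := D.g
  Q := D.Q
  hf := by have hf := D.hf; exact ⟨by omega, by omega, by omega, by omega⟩
  hg := D.hg
  hQc := D.hQc
  hQa := D.hQa
  a := D.a
  b := D.b
  u := D.u
  C := D.C
  P := D.P
  hab := D.hab
  hC := D.hC
  hCc := D.hCc
  hu := D.hu
  hP := D.hP
  hPc := D.hPc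

/-- A fenced bottom dual arm is an outer-fenced bottom dual arm. [folklore] -/
def ZdSepDualArmB.toOut (D : ZdSepDualArmB ω n N lo hi lo' hi') (hn : 1 ≤ n) (hlo : -(n : ℤ) ≤ lo)
    (hhi : hi + 1 ≤ n) : ZdOutDualArmB ω n N lo' hi' where
  f := D.f
  g := D.g
  Q := D.Q
  hf := by have hf := D.hf; exact ⟨by omega, by omega, by omega, by omega⟩
  hg := D.hg
  hQc := D.hQc
  hQa := D.hQa
  a := D.a
  b := D.b
  u := D.u
  C := D.C
  P := D.P
  hab := D.hab
  hC := D.hC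
  hCc := D.hCc
  hu := D.hu
  hP := D.hP
  hPc := D.hPc

/-- **`zdFourArmSep n N ⊆ zdFourArmOutLanded n N`** (`2 ≤ n`): forget the inner fences. [folklore] -/
theorem zdFourArmSep_subset_zdFourArmOutLanded (hn : 2 ≤ n) :
    zdFourArmSep n N ⊆ zdFourArmOutLanded n N := by
  rintro ω ⟨⟨⟨A⟩, ⟨B⟩⟩, ⟨⟨T⟩, ⟨D⟩⟩⟩
  have h64 : ((n / 64 : ℕ) : ℤ) + 1 ≤ n := by have : n / 64 < n := Nat.div_lt_self (by omega) (by norm_num); omega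
  exact ⟨⟨⟨A.toOut (by omega) (by omega) (by omega)⟩, ⟨B.toOut (by omega) (by omega) (by omega)⟩⟩,
    ⟨⟨T.toOut (by omega) (by omega) h64⟩, ⟨D.toOut (by omega) (by omega) h64⟩⟩⟩

end Forget

/-! ### Raising the inner radius -/

section Raise

variable {ω : BondConfig (Site 2)} {m m' N : ℕ} {lo' hi' : ℤ}

/-- A neighbour of a site of `B(k-1)` lies in `B(k)` (`1 ≤ k`). [folklore] -/
theorem mem_box_of_adj_of_mem_box_pred {k : ℕ} (hk : 1 ≤ k) {x z : Site 2} (hx : x ∈ box 2 (k - 1))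
    (h : (zdGraph 2).Adj x z) : z ∈ box 2 k := by
  rw [mem_box] at hx ⊢
  have h0 := hx 0
  have h1 := hx 1
  refine Fin.forall_fin_two.2 ⟨?_, ?_⟩ <;>
    rcases stepKind_of_adj h with ⟨e0, e1⟩ | ⟨e0, e1⟩ | ⟨e1, e0⟩ | ⟨e1, e0⟩ <;> constructor <;> omega

/-- **The last dart satisfying a property, and the suffix after it**: either no dart of `p`
satisfies `P`, or `p` has a dart `d` with `P d` followed by a suffix none of whose darts
satisfies `P`. [folklore] -/
theorem exists_dart_suffix_forall_not {V : Type*} {G : SimpleGraph V} {u v : V} (p : G.Walk u v)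
    (P : G.Dart → Prop) :
    (∀ d ∈ p.darts, ¬ P d) ∨
      ∃ d ∈ p.darts, P d ∧ ∃ q : G.Walk d.snd v, (∀ w ∈ q.support, w ∈ p.support) ∧
        (∀ d' ∈ q.darts, d' ∈ p.darts) ∧ ∀ d' ∈ q.darts, ¬ P d' := by
  classical
  induction p with
  | nil => exact Or.inl (by simp)
  | @cons a b c h p ih =>
    rcases ih with hall | ⟨d, hd, hPd, q, hqs, hqd, hqP⟩
    · by_cases hP : P ⟨(a, b), h⟩
      · refine Or.inr ⟨⟨(a, b), h⟩, by simp, hP, p, fun w hw => by simp [hw], fun d' hd' => by simp [hd'],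
          hall⟩
      · refine Or.inl fun d hd => ?_
        rw [Walk.darts_cons, List.mem_cons] at hd
        rcases hd with rfl | hd
        · exact hP
        · exact hall d hd
    · exact Or.inr ⟨d, by simp [hd], hPd, q, fun w hw => by simp [hqs w hw], fun d' hd' => by simp [hqd d' hd'],
        hqP⟩

/-- **Both endpoints of the edge crossed by a step of faces `z → z'` are corners of the face `z'`.** [folklore] -/
theorem sepEdge_apply_mem_Icc_snd {z z' v : Site 2} (hadj : (zdGraph 2).Adj z z') (hv : v ∈ sepEdge z z') :
    (z' 0 ≤ v 0 ∧ v 0 ≤ z' 0 + 1) ∧ (z' 1 ≤ v 1 ∧ v 1 ≤ z' 1 + 1) := by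
  rcases stepKind_of_adj hadj with ⟨h0, h1⟩ | ⟨h0, h1⟩ | ⟨h1, h0⟩ | ⟨h1, h0⟩
  · obtain rfl : z' = z + Pi.single 0 1 := by simp [Site.eq_iff_two, h0, h1]
    rw [sepEdge_right, Sym2.mem_iff] at hv
    rcases hv with rfl | rfl <;> simp
  · obtain rfl : z = z' + Pi.single 0 1 := by simp [Site.eq_iff_two, h0, h1]
    rw [sepEdge_comm, sepEdge_right, Sym2.mem_iff] at hv
    rcases hv with rfl | rfl <;> simp
  · obtain rfl : z' = z + Pi.single 1 1 := by simp [Site.eq_iff_two, h0, h1]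
    rw [sepEdge_up, Sym2.mem_iff] at hv
    rcases hv with rfl | rfl <;> simp
  · obtain rfl : z = z' + Pi.single 1 1 := by simp [Site.eq_iff_two, h0, h1]
    rw [sepEdge_comm, sepEdge_up, Sym2.mem_iff] at hv
    rcases hv with rfl | rfl <;> simp

/-- A site of `A_{m,N}` off `B(m'-1)` lies in `A_{m',N}`. [folklore] -/
theorem mem_sqAnnulus_of_notMem_box {v : Site 2} (hv : v ∈ sqAnnulus m N) (hv' : v ∉ box 2 (m' - 1)) :
    v ∈ sqAnnulus m' N := by
  simp only [sqAnnulus, Finset.mem_coe, mem_annulus] at hv ⊢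
  exact ⟨hv.1, hv'⟩

/-- **Raising the inner radius of an outer-fenced right arm** (`m ≤ m' ≤ N`): keep the part of the
body after its last visit to `B(m'-1)`. [folklore] -/
theorem ZdOutOpenArmR.nonempty_of_le (A : ZdOutOpenArmR ω m N lo' hi') (hmm' : m ≤ m') (hm'N : m' ≤ N) :
    Nonempty (ZdOutOpenArmR ω m' N lo' hi') := by
  have hm : 1 ≤ m := one_le_of_mem_siteSphere A.hx
  rcases Nat.eq_or_lt_of_le hmm' with rfl | hlt
  · exact ⟨A⟩
  have hz := A.hz
  have hzA : A.z ∈ ({v | v ∉ box 2 (m' - 1)} : Set (Site 2)) := by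
    intro h'
    have := (mem_box.1 h' 0).2
    omega
  have hxA : A.x ∉ ({v | v ∉ box 2 (m' - 1)} : Set (Site 2)) := by
    have hx := A.hx
    simp only [siteSphere, Finset.mem_sdiff] at hx
    exact fun h' => h' (box_mono 2 (by omega) hx.1)
  obtain ⟨x', z', q, hx'z', hz', hA', hS', hE', -⟩ :=
    exists_prefix_exit (A := {v | v ∉ box 2 (m' - 1)}) A.W.reverse hzA hxA
  have hz'box : z' ∈ box 2 (m' - 1) := not_not.1 hz'
  have hx'a : x' ∈ box 2 m' := mem_box_of_adj_of_mem_box_pred (by omega) hz'box hx'z'.symm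
  refine ⟨{ A with
    x := x'
    W := q.reverse
    hx := Finset.mem_sdiff.2 ⟨hx'a, hA' x' q.end_mem_support⟩
    hW := fun v hv => ?_
    hWo := fun e he => ?_ }⟩
  · rw [Walk.support_reverse, List.mem_reverse] at hv
    have h1 : v ∈ A.W.support := by
      have := hS' v hv
      rwa [Walk.support_reverse, List.mem_reverse] at this
    exact mem_sqAnnulus_of_notMem_box (A.hW v h1) (hA' v hv)
  · rw [Walk.edges_reverse, List.mem_reverse] at he
    have := hE' e he
    rw [Walk.edges_reverse, List.mem_reverse] at this
    exact A.hWo e this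

/-- **Raising the inner radius of an outer-fenced left arm.** [folklore] -/
theorem ZdOutOpenArmL.nonempty_of_le (A : ZdOutOpenArmL ω m N lo' hi') (hmm' : m ≤ m') (hm'N : m' ≤ N) :
    Nonempty (ZdOutOpenArmL ω m' N lo' hi') := by
  have hm : 1 ≤ m := one_le_of_mem_siteSphere A.hx
  rcases Nat.eq_or_lt_of_le hmm' with rfl | hlt
  · exact ⟨A⟩
  have hz := A.hz
  have hzA : A.z ∈ ({v | v ∉ box 2 (m' - 1)} : Set (Site 2)) := by
    intro h'
    have := (mem_box.1 h' 0).1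
    omega
  have hxA : A.x ∉ ({v | v ∉ box 2 (m' - 1)} : Set (Site 2)) := by
    have hx := A.hx
    simp only [siteSphere, Finset.mem_sdiff] at hx
    exact fun h' => h' (box_mono 2 (by omega) hx.1)
  obtain ⟨x', z', q, hx'z', hz', hA', hS', hE', -⟩ :=
    exists_prefix_exit (A := {v | v ∉ box 2 (m' - 1)}) A.W.reverse hzA hxA
  have hz'box : z' ∈ box 2 (m' - 1) := not_not.1 hz'
  have hx'a : x' ∈ box 2 m' := mem_box_of_adj_of_mem_box_pred (by omega) hz'box hx'z'.symm
  refine ⟨{ A with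
    x := x'
    W := q.reverse
    hx := Finset.mem_sdiff.2 ⟨hx'a, hA' x' q.end_mem_support⟩
    hW := fun v hv => ?_
    hWo := fun e he => ?_ }⟩
  · rw [Walk.support_reverse, List.mem_reverse] at hv
    have h1 : v ∈ A.W.support := by
      have := hS' v hv
      rwa [Walk.support_reverse, List.mem_reverse] at this
    exact mem_sqAnnulus_of_notMem_box (A.hW v h1) (hA' v hv)
  · rw [Walk.edges_reverse, List.mem_reverse] at he
    have := hE' e he
    rw [Walk.edges_reverse, List.mem_reverse] at this
    exact A.hWo e this

/-- **Raising the inner radius of an outer-fenced top dual arm** (`m ≤ m'`): keep the part of the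
body after the last crossed edge having an endpoint in `B(m'-1)`; the face entered by that step
has that endpoint as a corner, so it lies inside `B(m')`. [folklore] -/
theorem ZdOutDualArmT.nonempty_of_le (D : ZdOutDualArmT ω m N lo' hi') (hm'1 : 1 ≤ m') (hmm' : m ≤ m') :
    Nonempty (ZdOutDualArmT ω m' N lo' hi') := by
  rcases exists_dart_suffix_forall_not D.Q (fun d => ∃ v ∈ sepEdge d.fst d.snd, v ∈ box 2 (m' - 1)) with
    hall | ⟨d, hd, ⟨v, hv, hvb⟩, q, -, hqd, hqP⟩
  · refine ⟨{ D with
      hf := by have hf := D.hf; exact ⟨by omega, by omega, by omega, by omega⟩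
      hQa := fun d hd v hv => mem_sqAnnulus_of_notMem_box (D.hQa d hd v hv) fun h => hall d hd ⟨v, hv, h⟩ }⟩
  · obtain ⟨⟨c0, c0'⟩, ⟨c1, c1'⟩⟩ := sepEdge_apply_mem_Icc_snd d.adj hv
    obtain ⟨hb0, hb0'⟩ := mem_box.1 hvb 0
    obtain ⟨hb1, hb1'⟩ := mem_box.1 hvb 1
    refine ⟨{ D with
      f := d.snd
      Q := q
      hf := ⟨by omega, by omega, by omega, by omega⟩
      hQc := fun d' hd' => D.hQc d' (hqd d' hd')
      hQa := fun d' hd' w hw => mem_sqAnnulus_of_notMem_box (D.hQa d' (hqd d' hd') w hw)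
        fun h => hqP d' hd' ⟨w, hw, h⟩ }⟩

/-- **Raising the inner radius of an outer-fenced bottom dual arm.** [folklore] -/
theorem ZdOutDualArmB.nonempty_of_le (D : ZdOutDualArmB ω m N lo' hi') (hm'1 : 1 ≤ m') (hmm' : m ≤ m') :
    Nonempty (ZdOutDualArmB ω m' N lo' hi') := by
  rcases exists_dart_suffix_forall_not D.Q (fun d => ∃ v ∈ sepEdge d.fst d.snd, v ∈ box 2 (m' - 1)) with
    hall | ⟨d, hd, ⟨v, hv, hvb⟩, q, -, hqd, hqP⟩
  · refine ⟨{ D with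
      hf := by have hf := D.hf; exact ⟨by omega, by omega, by omega, by omega⟩
      hQa := fun d hd v hv => mem_sqAnnulus_of_notMem_box (D.hQa d hd v hv) fun h => hall d hd ⟨v, hv, h⟩ }⟩
  · obtain ⟨⟨c0, c0'⟩, ⟨c1, c1'⟩⟩ := sepEdge_apply_mem_Icc_snd d.adj hv
    obtain ⟨hb0, hb0'⟩ := mem_box.1 hvb 0
    obtain ⟨hb1, hb1'⟩ := mem_box.1 hvb 1
    refine ⟨{ D with
      f := d.snd
      Q := q
      hf := ⟨by omega, by omega, by omega, by omega⟩
      hQc := fun d' hd' => D.hQc d' (hqd d' hd')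
      hQa := fun d' hd' w hw => mem_sqAnnulus_of_notMem_box (D.hQa d' (hqd d' hd') w hw)
        fun h => hqP d' hd' ⟨w, hw, h⟩ }⟩

/-- **Raising the inner radius: `zdFourArmOutLanded m N ⊆ zdFourArmOutLanded m' N`** for
`m ≤ m' ≤ N` — the inclusion `E ⊆ E'` of the inward surgery step (`real_le_add_mul_of_surgery`).
(Nolin 2008, §4.4, "2. Internal extremities"; van den Berg–Nolin: arm events are non-decreasing
in the inner radius.) [cite: Nolin2008, §4.4, proof of Thm. 11, internal extremities (arXiv 0711.4948: Thm. 10, p. 13)] -/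
theorem zdFourArmOutLanded_mono_left (hmm' : m ≤ m') (hm'N : m' ≤ N) :
    zdFourArmOutLanded m N ⊆ zdFourArmOutLanded m' N := by
  rintro ω ⟨⟨⟨A⟩, ⟨B⟩⟩, ⟨⟨T⟩, ⟨D⟩⟩⟩
  have hm'1 : 1 ≤ m' := (one_le_of_mem_siteSphere A.hx).trans hmm'
  exact ⟨⟨A.nonempty_of_le hmm' hm'N, B.nonempty_of_le hmm' hm'N⟩,
    ⟨T.nonempty_of_le hm'1 hmm', D.nonempty_of_le hm'1 hmm'⟩⟩

end Raise

/-! ### Locality: the event is read off the pairs of `B(N + N/8 + 1) ∖ B(n-1)` -/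

section Locality

variable {ω ω' : BondConfig (Site 2)} {n N : ℕ} {lo' hi' : ℤ}

/-- The pairs off the hole `B(n-1)` and inside `B(N + N/8 + 1)`. [folklore] -/
def outLandedPairs (n N : ℕ) : Finset (Sym2 (Site 2)) :=
  (annulus 2 (n - 1) (N + N / 8 + 1)).sym2

/-- Membership in `outLandedPairs`, in coordinates of the endpoints. [folklore] -/
theorem mem_outLandedPairs_of_forall (hn : 1 ≤ n) {e : Sym2 (Site 2)}
    (h : ∀ v ∈ e, (∀ i, -((N : ℤ) + (N / 8 : ℕ) + 1) ≤ v i ∧ v i ≤ (N : ℤ) + (N / 8 : ℕ) + 1) ∧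
      ∃ i, (n : ℤ) ≤ v i ∨ v i ≤ -(n : ℤ)) :
    e ∈ (outLandedPairs n N : Set (Sym2 (Site 2))) := by
  refine Finset.mem_coe.2 (Finset.mem_sym2_iff.2 fun v hv => ?_)
  obtain ⟨h1, i, hi⟩ := h v hv
  rw [mem_annulus, mem_box, mem_box]
  refine ⟨fun j => ⟨by have := h1 j; omega, by have := h1 j; omega⟩, fun hb => ?_⟩
  have := hb i
  omega

/-- A site of `A_{n,N}` qualifies. [folklore] -/
theorem outLanded_site_of_mem_sqAnnulus (hn : 1 ≤ n) {v : Site 2} (hv : v ∈ sqAnnulus n N) :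
    (∀ i, -((N : ℤ) + (N / 8 : ℕ) + 1) ≤ v i ∧ v i ≤ (N : ℤ) + (N / 8 : ℕ) + 1) ∧
      ∃ i, (n : ℤ) ≤ v i ∨ v i ≤ -(n : ℤ) := by
  rw [mem_sqAnnulus_iff hn] at hv
  exact ⟨fun i => by have := hv.1 i; exact ⟨by omega, by omega⟩, hv.2⟩

/-- **Transport of an outer-fenced right arm** along configurations agreeing on `outLandedPairs`
(`1 ≤ n`, `2n ≤ N`). [folklore] -/
def ZdOutOpenArmR.transport (A : ZdOutOpenArmR ω n N lo' hi') (hn : 1 ≤ n) (h2 : 2 * n ≤ N)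
    (hlo' : -((N / 64 : ℕ) : ℤ) ≤ lo') (hhi' : hi' ≤ (N / 64 : ℕ))
    (h : ∀ e ∈ (outLandedPairs n N : Set (Sym2 (Site 2))), e ∈ ω → e ∈ ω') : ZdOutOpenArmR ω' n N lo' hi' :=
  have hz := A.hz
  have h8 : (N / 8 : ℕ) ≤ N := Nat.div_le_self N 8
  have h64 : (N / 64 : ℕ) ≤ N / 8 := Nat.div_le_div_left (by norm_num) (by norm_num)
  have h82 : 2 * (N / 8) + 2 ≤ N + 2 := by omega
  { A with
    hWo := fun e he => h e (mem_outLandedPairs_of_forall hn fun v hv =>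
      outLanded_site_of_mem_sqAnnulus hn (A.hW v (forall_mem_support_of_mem_edges A.W he v hv))) (A.hWo e he)
    hVo := fun e he => h e (mem_outLandedPairs_of_forall hn fun v hv => by
      obtain ⟨a0, a0', a1⟩ := A.hV v (forall_mem_support_of_mem_edges A.V he v hv)
      have e1 := abs_le.1 a1
      exact ⟨Fin.forall_fin_two.2 ⟨⟨by omega, by omega⟩, ⟨by omega, by omega⟩⟩, 0, Or.inl (by omega)⟩) (A.hVo e he)
    hPo := fun e he => h e (mem_outLandedPairs_of_forall hn fun v hv => by
      obtain ⟨a0, a1⟩ := A.hP v (forall_mem_support_of_mem_edges A.P he v hv)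
      have e0 := abs_le.1 (show |v 0 - A.z 0| ≤ (N / 8 : ℕ) by omega)
      have e1 := abs_le.1 (show |v 1 - A.z 1| ≤ (N / 8 : ℕ) by omega)
      exact ⟨Fin.forall_fin_two.2 ⟨⟨by omega, by omega⟩, ⟨by omega, by omega⟩⟩, 0, Or.inl (by omega)⟩) (A.hPo e he) }

/-- **Transport of an outer-fenced left arm.** [folklore] -/
def ZdOutOpenArmL.transport (A : ZdOutOpenArmL ω n N lo' hi') (hn : 1 ≤ n) (h2 : 2 * n ≤ N)
    (hlo' : -((N / 64 : ℕ) : ℤ) ≤ lo') (hhi' : hi' ≤ (N / 64 : ℕ))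
    (h : ∀ e ∈ (outLandedPairs n N : Set (Sym2 (Site 2))), e ∈ ω → e ∈ ω') : ZdOutOpenArmL ω' n N lo' hi' :=
  have hz := A.hz
  have h8 : (N / 8 : ℕ) ≤ N := Nat.div_le_self N 8
  have h64 : (N / 64 : ℕ) ≤ N / 8 := Nat.div_le_div_left (by norm_num) (by norm_num)
  have h82 : 2 * (N / 8) + 2 ≤ N + 2 := by omega
  { A with
    hWo := fun e he => h e (mem_outLandedPairs_of_forall hn fun v hv =>
      outLanded_site_of_mem_sqAnnulus hn (A.hW v (forall_mem_support_of_mem_edges A.W he v hv))) (A.hWo e he)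
    hVo := fun e he => h e (mem_outLandedPairs_of_forall hn fun v hv => by
      obtain ⟨a0, a0', a1⟩ := A.hV v (forall_mem_support_of_mem_edges A.V he v hv)
      have e1 := abs_le.1 a1
      exact ⟨Fin.forall_fin_two.2 ⟨⟨by omega, by omega⟩, ⟨by omega, by omega⟩⟩, 0, Or.inr (by omega)⟩) (A.hVo e he)
    hPo := fun e he => h e (mem_outLandedPairs_of_forall hn fun v hv => by
      obtain ⟨a0, a1⟩ := A.hP v (forall_mem_support_of_mem_edges A.P he v hv)
      have e0 := abs_le.1 (show |v 0 - A.z 0| ≤ (N / 8 : ℕ) by omega)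
      have e1 := abs_le.1 (show |v 1 - A.z 1| ≤ (N / 8 : ℕ) by omega)
      exact ⟨Fin.forall_fin_two.2 ⟨⟨by omega, by omega⟩, ⟨by omega, by omega⟩⟩, 0, Or.inr (by omega)⟩) (A.hPo e he) }

/-- **Transport of an outer-fenced top dual arm** along configurations agreeing on
`outLandedPairs` (closed pairs stay closed). [folklore] -/
def ZdOutDualArmT.transport (D : ZdOutDualArmT ω n N lo' hi') (hn : 1 ≤ n) (h2 : 2 * n ≤ N)
    (hlo' : -((N / 64 : ℕ) : ℤ) ≤ lo') (hhi' : hi' ≤ (N / 64 : ℕ))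
    (h : ∀ e ∈ (outLandedPairs n N : Set (Sym2 (Site 2))), e ∉ ω → e ∉ ω') : ZdOutDualArmT ω' n N lo' hi' :=
  have hg := D.hg
  have h8 : (N / 8 : ℕ) ≤ N := Nat.div_le_self N 8
  have h64 : (N / 64 : ℕ) ≤ N / 8 := Nat.div_le_div_left (by norm_num) (by norm_num)
  have h82 : 2 * (N / 8) + 2 ≤ N + 2 := by omega
  { D with
    hQc := fun d hd => h _ (mem_outLandedPairs_of_forall hn fun v hv =>
      outLanded_site_of_mem_sqAnnulus hn (D.hQa d hd v hv)) (D.hQc d hd)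
    hCc := fun d hd => h _ (mem_outLandedPairs_of_forall hn fun v hv => by
      obtain ⟨⟨c0, c0'⟩, ⟨c1, c1'⟩⟩ := sepEdge_apply_le hv
      obtain ⟨a0, a1, a1'⟩ := D.hC _ (D.C.dart_fst_mem_support_of_mem_darts hd)
      obtain ⟨b0, b1, b1'⟩ := D.hC _ (D.C.dart_snd_mem_support_of_mem_darts hd)
      have ea := abs_le.1 a0
      have eb := abs_le.1 b0
      refine ⟨Fin.forall_fin_two.2 ⟨?_, ?_⟩, 1, Or.inl ?_⟩
      · rcases le_total (d.fst 0) (d.snd 0) with hle | hle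
        · rw [max_eq_right hle] at c0 c0'; exact ⟨by omega, by omega⟩
        · rw [max_eq_left hle] at c0 c0'; exact ⟨by omega, by omega⟩
      · rcases le_total (d.fst 1) (d.snd 1) with hle | hle
        · rw [max_eq_right hle] at c1 c1'; exact ⟨by omega, by omega⟩
        · rw [max_eq_left hle] at c1 c1'; exact ⟨by omega, by omega⟩
      · rcases le_total (d.fst 1) (d.snd 1) with hle | hle
        · rw [max_eq_right hle] at c1; omega
        · rw [max_eq_left hle] at c1; omega) (D.hCc d hd)
    hPc := fun d hd => h _ (mem_outLandedPairs_of_forall hn fun v hv => by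
      obtain ⟨⟨c0, c0'⟩, ⟨c1, c1'⟩⟩ := sepEdge_apply_le hv
      obtain ⟨a0, a1⟩ := D.hP _ (D.P.dart_fst_mem_support_of_mem_darts hd)
      obtain ⟨b0, b1⟩ := D.hP _ (D.P.dart_snd_mem_support_of_mem_darts hd)
      have ea0 := abs_le.1 (show |d.fst 0 - D.g 0| ≤ (N / 8 : ℕ) by omega)
      have ea1 := abs_le.1 (show |d.fst 1 - D.g 1| ≤ (N / 8 : ℕ) by omega)
      have eb0 := abs_le.1 (show |d.snd 0 - D.g 0| ≤ (N / 8 : ℕ) by omega)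
      have eb1 := abs_le.1 (show |d.snd 1 - D.g 1| ≤ (N / 8 : ℕ) by omega)
      refine ⟨Fin.forall_fin_two.2 ⟨?_, ?_⟩, 1, Or.inl ?_⟩
      · rcases le_total (d.fst 0) (d.snd 0) with hle | hle
        · rw [max_eq_right hle] at c0 c0'; exact ⟨by omega, by omega⟩
        · rw [max_eq_left hle] at c0 c0'; exact ⟨by omega, by omega⟩
      · rcases le_total (d.fst 1) (d.snd 1) with hle | hle
        · rw [max_eq_right hle] at c1 c1'; exact ⟨by omega, by omega⟩
        · rw [max_eq_left hle] at c1 c1'; exact ⟨by omega, by omega⟩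
      · rcases le_total (d.fst 1) (d.snd 1) with hle | hle
        · rw [max_eq_right hle] at c1; omega
        · rw [max_eq_left hle] at c1; omega) (D.hPc d hd) }

/-- **Transport of an outer-fenced bottom dual arm.** [folklore] -/
def ZdOutDualArmB.transport (D : ZdOutDualArmB ω n N lo' hi') (hn : 1 ≤ n) (h2 : 2 * n ≤ N)
    (hlo' : -((N / 64 : ℕ) : ℤ) ≤ lo') (hhi' : hi' ≤ (N / 64 : ℕ))
    (h : ∀ e ∈ (outLandedPairs n N : Set (Sym2 (Site 2))), e ∉ ω → e ∉ ω') : ZdOutDualArmB ω' n N lo' hi' :=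
  have hg := D.hg
  have h8 : (N / 8 : ℕ) ≤ N := Nat.div_le_self N 8
  have h64 : (N / 64 : ℕ) ≤ N / 8 := Nat.div_le_div_left (by norm_num) (by norm_num)
  have h82 : 2 * (N / 8) + 2 ≤ N + 2 := by omega
  { D with
    hQc := fun d hd => h _ (mem_outLandedPairs_of_forall hn fun v hv =>
      outLanded_site_of_mem_sqAnnulus hn (D.hQa d hd v hv)) (D.hQc d hd)
    hCc := fun d hd => h _ (mem_outLandedPairs_of_forall hn fun v hv => by
      obtain ⟨⟨c0, c0'⟩, ⟨c1, c1'⟩⟩ := sepEdge_apply_le hv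
      obtain ⟨a0, a1, a1'⟩ := D.hC _ (D.C.dart_fst_mem_support_of_mem_darts hd)
      obtain ⟨b0, b1, b1'⟩ := D.hC _ (D.C.dart_snd_mem_support_of_mem_darts hd)
      have ea := abs_le.1 a0
      have eb := abs_le.1 b0
      refine ⟨Fin.forall_fin_two.2 ⟨?_, ?_⟩, 1, Or.inr ?_⟩
      · rcases le_total (d.fst 0) (d.snd 0) with hle | hle
        · rw [max_eq_right hle] at c0 c0'; exact ⟨by omega, by omega⟩
        · rw [max_eq_left hle] at c0 c0'; exact ⟨by omega, by omega⟩
      · rcases le_total (d.fst 1) (d.snd 1) with hle | hle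
        · rw [max_eq_right hle] at c1 c1'; exact ⟨by omega, by omega⟩
        · rw [max_eq_left hle] at c1 c1'; exact ⟨by omega, by omega⟩
      · rcases le_total (d.fst 1) (d.snd 1) with hle | hle
        · rw [max_eq_right hle] at c1'; omega
        · rw [max_eq_left hle] at c1'; omega) (D.hCc d hd)
    hPc := fun d hd => h _ (mem_outLandedPairs_of_forall hn fun v hv => by
      obtain ⟨⟨c0, c0'⟩, ⟨c1, c1'⟩⟩ := sepEdge_apply_le hv
      obtain ⟨a0, a1⟩ := D.hP _ (D.P.dart_fst_mem_support_of_mem_darts hd)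
      obtain ⟨b0, b1⟩ := D.hP _ (D.P.dart_snd_mem_support_of_mem_darts hd)
      have ea0 := abs_le.1 (show |d.fst 0 - D.g 0| ≤ (N / 8 : ℕ) by omega)
      have ea1 := abs_le.1 (show |d.fst 1 - D.g 1| ≤ (N / 8 : ℕ) by omega)
      have eb0 := abs_le.1 (show |d.snd 0 - D.g 0| ≤ (N / 8 : ℕ) by omega)
      have eb1 := abs_le.1 (show |d.snd 1 - D.g 1| ≤ (N / 8 : ℕ) by omega)
      refine ⟨Fin.forall_fin_two.2 ⟨?_, ?_⟩, 1, Or.inr ?_⟩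
      · rcases le_total (d.fst 0) (d.snd 0) with hle | hle
        · rw [max_eq_right hle] at c0 c0'; exact ⟨by omega, by omega⟩
        · rw [max_eq_left hle] at c0 c0'; exact ⟨by omega, by omega⟩
      · rcases le_total (d.fst 1) (d.snd 1) with hle | hle
        · rw [max_eq_right hle] at c1 c1'; exact ⟨by omega, by omega⟩
        · rw [max_eq_left hle] at c1 c1'; exact ⟨by omega, by omega⟩
      · rcases le_total (d.fst 1) (d.snd 1) with hle | hle
        · rw [max_eq_right hle] at c1'; omega
        · rw [max_eq_left hle] at c1'; omega) (D.hPc d hd) }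

/-- **The outer-landed four-arm event is determined by the pairs of `B(N + N/8 + 1) ∖ B(n-1)`**
(`1 ≤ n`, `2n ≤ N`): all its open pieces are open walks there and all its closed pieces are edges
with both endpoints there. [folklore] -/
theorem determinedBy_zdFourArmOutLanded (hn : 1 ≤ n) (h2 : 2 * n ≤ N) :
    DeterminedBy (zdFourArmOutLanded n N) ↑(outLandedPairs n N) := by
  have h0 : -((N / 64 : ℕ) : ℤ) ≤ 0 := by omega
  suffices key : ∀ ω ω' : BondConfig (Site 2), ω ∩ ↑(outLandedPairs n N) = ω' ∩ ↑(outLandedPairs n N) →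
      ω ∈ zdFourArmOutLanded n N → ω' ∈ zdFourArmOutLanded n N by
    rw [determinedBy_iff]
    exact fun ω ω' h => ⟨key ω ω' h, key ω' ω h.symm⟩
  rintro ω ω' h ⟨⟨⟨A⟩, ⟨B⟩⟩, ⟨⟨T⟩, ⟨D⟩⟩⟩
  have hop : ∀ e ∈ (outLandedPairs n N : Set (Sym2 (Site 2))), e ∈ ω → e ∈ ω' :=
    fun e he heω => mem_of_inter_eq h he heω
  have hcl : ∀ e ∈ (outLandedPairs n N : Set (Sym2 (Site 2))), e ∉ ω → e ∉ ω' :=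
    fun e he heω h' => heω (mem_of_inter_eq h.symm he h')
  exact ⟨⟨⟨A.transport hn h2 h0 le_rfl hop⟩, ⟨B.transport hn h2 h0 le_rfl hop⟩⟩,
    ⟨⟨T.transport hn h2 h0 le_rfl hcl⟩, ⟨D.transport hn h2 h0 le_rfl hcl⟩⟩⟩

/-- The outer-landed four-arm event is measurable (`1 ≤ n`, `2n ≤ N`). [folklore] -/
theorem measurableSet_zdFourArmOutLanded (hn : 1 ≤ n) (h2 : 2 * n ≤ N) :
    MeasurableSet (zdFourArmOutLanded n N) :=
  (determinedBy_zdFourArmOutLanded hn h2).measurableSet_of_finset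

/-- **The pairs of the outer-landed event avoid every set of pairs reaching inside `B(n-1)`** — the
support condition of the inward surgery step. [folklore] -/
theorem disjoint_outLandedPairs {T : Set (Sym2 (Site 2))} (hT : ∀ e ∈ T, ∃ v ∈ e, v ∈ box 2 (n - 1)) :
    Disjoint (↑(outLandedPairs n N) : Set (Sym2 (Site 2))) T := by
  rw [Set.disjoint_left]
  intro e he heT
  obtain ⟨v, hv, hvm⟩ := hT e heT
  have hv' : v ∈ annulus 2 (n - 1) (N + N / 8 + 1) := Finset.mem_sym2_iff.1 (Finset.mem_coe.1 he) v hv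
  exact (mem_annulus.1 hv').2 hvm

end Locality

end Literature.Probability.Percolation

end
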